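import Summits.Ventures.HSemireg.Pad4TowerLineStaticSpread
import Summits.Ventures.HSemireg.PhaseTorusLawTen

/-!
# PAD-4 on 𝔅(μ₄): the BOX LAW at DESIGN level — `μ = −32·(N₀ + i·N₁) ∈ 32ℤ[i]` for every integer (A1)-clean LINE design,
# `μ ≠ 0 ⇒ |μ|² ≥ 1024`, and the UP two-term law through corank 10 UNCONDITIONALLY
# (HSemireg support file; phase-torus line, «control» lens g6 CYCLE LINE «BOX LAW ∕ μ-LATTICE», design level)

Crux of record: `Summit.HodgeConjecture.HodgeConjecture.Theses.EightfoldBlochSeeds.BlochSeedDiscOne`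
(= `HasHyperbolicBlochSeed 4 1`, item stmt-HodgeConjecture-18881; skeleton `Lines/birth.lean`, STUB R `stub_rung_pad4_seedAt`,
named technique = PAD-4 two-level ⊕-block design with a TWO-TERM line-bundle presentation).
Nothing in this file proves HC, HC_AV, HC_CM, H2 or item 18881; census-neutral (no SAT∕UNSAT row is added or changed).

WHAT THIS FILE IS (tree copy of the crux workfile `Cruxes/BlochSeedDiscOne/LinePhaseTorusBoxLaw.lean` e58a616ee2538c3d, author
plan-lens-HodgeAV-control g6, statements verbatim over the tree's STATIC measure `omegaS` of `Pad4TowerLineStaticSpread` (= the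
workfile's `omegaD`, `vol = ∏_f lineCharge`); pen proof + data 41∕41 designs of record: memo `Cruxes/BlochSeedDiscOne/BOX-LAW-g6.md`;
director-hodge words «K-μ32» (LINE) and «K-UP10»; critic idea-crit-6 g12 KERNEL PLATE l.6709∕6744 on the crux-dir bytes):
* the dictionary in `PhaseTorus.moment` form: the torus moments of `ω_S` ARE the design moments (`omegaS_moment_eq`, from
  `omegaS_moment`), (A1) on the LINE ⇒ `ω_S` is clean (`omegaS_kadm_clean`), top moment `= μ = C.wch mN mP eWord` (`omegaS_moment_one`);
* `boxCount h C mN mP s` — the signed, volume-weighted count of the design's cells whose phase vector lies in the box `s + {0,1}⁴`;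
* **`lineDesign_mu_eq_boxCounts`** — `C.wch mN mP eWord = ⟨−32·N₀, −32·N₁⟩` (`N₀ = boxCount … 0`, `N₁ = boxCount … e₀`), from the
  torus μ-lattice theorem `PhaseTorusBoxLaw.moment_one_eq_boxSums`; ANY integer multiplicities (no sign, no flow, no Hall, no
  orbit-constancy, every `h`);
* **`lineDesign_mu_dvd`** — `32 ∣ re μ ∧ 32 ∣ im μ`;  **`lineDesign_norm_mu_ge`** — `μ ≠ 0 ⇒ |μ|² ≥ 1024` (|μ| = 32 is attained: crux-dir
  `SharpWitness32.lean`, not a tree file);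
* **`lineTwoTermUp10_mu_eq_zero`** — the UP law `Pad4TowerLinePhaseTorus.lineTwoTermUp_mu_eq_zero_of_law 10` with its torus hypothesis
  `hPT` DISCHARGED by `PhaseTorusLawTen.phaseTorusLawN_ten`: an (A1)-clean LINE UP two-term design (`m ≥ 0`, an `UpFlow`) with
  `Σ m_N − Σ m_P ≤ 10` has `μ = 0`.
Everything here is PROVED (axioms `propext`, `Classical.choice`, `Quot.sound`; no `sorry`, no named fact, no instance, no notation).

WHAT IT IS NOT: a statement about monads beyond these necessary conditions on ONE presentation class (two-term LINE designs), about
non-LINE letters, ≥ 3-term complexes, the semi-homogeneous alphabet, a SOURCE or a SEED.  The corank-free UP law is FALSE at the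
torus level from corank 16 on (`PhaseTorusLawCoranks.not_phaseTorusLawN_sixteen`); this file does not claim a design realises `ω₁₆`.
Tree filing: hsemireg-phasetorus-typer-1 g2.
-/

namespace Summit.Ventures.HSemireg.LinePhaseTorus

open Finset BigOperators Summit.Ventures.HSemireg Summit.Ventures.HSemireg.Pad4Tower

/-! ## §1 The static measure in `PhaseTorus.moment` form -/

/-- **dictionary** (`omegaS_moment` in `PhaseTorus.moment` form): the torus moments of `ω_S` at `2`-free frequencies are the design
moments of the corresponding top words. -/
theorem omegaS_moment_eq (h : ℤ) (C : MConfig) (mN mP : MCell → ℤ) (hline : ∀ Z ∈ C.lower ∪ C.upper, LineCell h Z)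
    (k : Fin 4 → ZMod 4) (hk : ∀ f, k f ≠ 2) :
    PhaseTorus.moment (fun τ => ((omegaS h C mN mP τ : ℤ) : ℝ)) k = ((moment h C mN mP (wordOf k) : GaussianInt) : ℂ) :=
  omegaS_moment h C mN mP hline k hk

/-- **(A1) on the LINE ⇒ `ω_S` is clean**: every admissible torus moment of `ω_S` vanishes. -/
theorem omegaS_kadm_clean (h : ℤ) (C : MConfig) (mN mP : MCell → ℤ) (hline : ∀ Z ∈ C.lower ∪ C.upper, LineCell h Z)
    (hA1 : ClassScreen (C.wch mN mP)) (k : Fin 4 → ZMod 4) (hk : PhaseTorus.KAdm k) :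
    PhaseTorus.moment (fun τ => ((omegaS h C mN mP τ : ℤ) : ℝ)) k = 0 :=
  omegaS_clean h C mN mP hline hA1 k hk

/-- **the top torus moment of `ω_S` is `μ = wch(eeee)`**. -/
theorem omegaS_moment_one (h : ℤ) (C : MConfig) (mN mP : MCell → ℤ) (hline : ∀ Z ∈ C.lower ∪ C.upper, LineCell h Z) :
    PhaseTorus.moment (fun τ => ((omegaS h C mN mP τ : ℤ) : ℝ)) (fun _ => 1) = ((C.wch mN mP eWord : GaussianInt) : ℂ) := by
  rw [omegaS_moment_eq h C mN mP hline (fun _ => 1) (fun _ => by decide), wordOf_one, wch_eWord_eq_moment_beta h]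

/-! ## §2 The box law for LINE designs: `μ = −32·(N₀ + i·N₁)` -/

/-- signed, volume-weighted count of the design's cells whose phase vector lies in the box with corner `s`. -/
def boxCount (h : ℤ) (C : MConfig) (mN mP : MCell → ℤ) (s : Fin 4 → ZMod 4) : ℤ :=
  ∑ τ ∈ PhaseTorus.pbox s, omegaS h C mN mP τ

/-- **BOX LAW for LINE designs**: `μ = −32·(N₀ + i·N₁)` for every integer (A1)-clean LINE design. -/
theorem lineDesign_mu_eq_boxCounts (h : ℤ) (C : MConfig) (mN mP : MCell → ℤ)
    (hline : ∀ Z ∈ C.lower ∪ C.upper, LineCell h Z) (hA1 : ClassScreen (C.wch mN mP)) :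
    C.wch mN mP eWord = ⟨-32 * boxCount h C mN mP 0, -32 * boxCount h C mN mP (Pi.single 0 1)⟩ := by
  have hK : ∀ k, PhaseTorus.KAdm k → PhaseTorus.moment (fun τ => ((omegaS h C mN mP τ : ℤ) : ℝ)) k = 0 :=
    fun k hk => omegaS_kadm_clean h C mN mP hline hA1 k hk
  have hμ := PhaseTorus.moment_one_eq_boxSums (fun τ => ((omegaS h C mN mP τ : ℤ) : ℝ)) hK
  rw [omegaS_moment_one h C mN mP hline, PhaseTorus.boxSum_intCast, PhaseTorus.boxSum_intCast] at hμ
  apply GaussianInt.toComplex_injective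
  rw [hμ, GaussianInt.toComplex_def']
  unfold boxCount
  push_cast
  ring

/-- **`μ ∈ 32ℤ[i]`** for every integer (A1)-clean LINE design (any height, support, multiplicities, signs). -/
theorem lineDesign_mu_dvd (h : ℤ) (C : MConfig) (mN mP : MCell → ℤ)
    (hline : ∀ Z ∈ C.lower ∪ C.upper, LineCell h Z) (hA1 : ClassScreen (C.wch mN mP)) :
    (32 : ℤ) ∣ (C.wch mN mP eWord).re ∧ (32 : ℤ) ∣ (C.wch mN mP eWord).im := by
  rw [lineDesign_mu_eq_boxCounts h C mN mP hline hA1]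
  refine ⟨⟨-boxCount h C mN mP 0, ?_⟩, ⟨-boxCount h C mN mP (Pi.single 0 1), ?_⟩⟩
  · show -32 * boxCount h C mN mP 0 = 32 * -boxCount h C mN mP 0
    ring
  · show -32 * boxCount h C mN mP (Pi.single 0 1) = 32 * -boxCount h C mN mP (Pi.single 0 1)
    ring

/-- **the gap**: `μ ≠ 0 ⇒ |μ|² ≥ 1024` (so `|μ| ≥ 32` on LINE alphabets). -/
theorem lineDesign_norm_mu_ge (h : ℤ) (C : MConfig) (mN mP : MCell → ℤ)
    (hline : ∀ Z ∈ C.lower ∪ C.upper, LineCell h Z) (hA1 : ClassScreen (C.wch mN mP))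
    (hμ : C.wch mN mP eWord ≠ 0) : 1024 ≤ (C.wch mN mP eWord).norm := by
  have hbox := lineDesign_mu_eq_boxCounts h C mN mP hline hA1
  rw [hbox] at hμ ⊢
  have hne : boxCount h C mN mP 0 ≠ 0 ∨ boxCount h C mN mP (Pi.single 0 1) ≠ 0 := by
    by_contra hc
    push Not at hc
    apply hμ
    rw [hc.1, hc.2]
    rfl
  rw [Zsqrtd.norm_def]
  show (1024 : ℤ) ≤ -32 * boxCount h C mN mP 0 * (-32 * boxCount h C mN mP 0) -
      -1 * (-32 * boxCount h C mN mP (Pi.single 0 1)) * (-32 * boxCount h C mN mP (Pi.single 0 1))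
  rcases hne with ha | hb
  · have := Int.one_le_abs ha
    nlinarith [sq_abs (boxCount h C mN mP 0), sq_nonneg (boxCount h C mN mP (Pi.single 0 1)),
      abs_nonneg (boxCount h C mN mP 0)]
  · have := Int.one_le_abs hb
    nlinarith [sq_abs (boxCount h C mN mP (Pi.single 0 1)), sq_nonneg (boxCount h C mN mP 0),
      abs_nonneg (boxCount h C mN mP (Pi.single 0 1))]

/-! ## §3 The UP law through corank 10, unconditional -/

/-- **the UP law at corank ≤ 10, UNCONDITIONAL**: `lineTwoTermUp_mu_eq_zero_of_law 10` with `hPT` discharged by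
`PhaseTorus.phaseTorusLawN_ten` (box law + double counting). -/
theorem lineTwoTermUp10_mu_eq_zero (h : ℤ) (C : MConfig) (mN mP : MCell → ℤ)
    (hmN : ∀ Z, 0 ≤ mN Z) (hmP : ∀ P, 0 ≤ mP P)
    (hline : ∀ Z ∈ C.lower ∪ C.upper, LineCell h Z) (hA1 : ClassScreen (C.wch mN mP))
    (F : UpFlow C mN mP) (hrank : (∑ Z ∈ C.lower, mN Z) - (∑ P ∈ C.upper, mP P) ≤ 10) :
    C.wch mN mP eWord = 0 :=
  lineTwoTermUp_mu_eq_zero_of_law 10 (fun ω A hA hω hK => PhaseTorus.phaseTorusLawN_ten ω A hA hω hK)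
    h C mN mP hmN hmP hline hA1 F (by exact_mod_cast hrank)

end Summit.Ventures.HSemireg.LinePhaseTorus
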